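import Literature.MathematicalPhysics.QuantumFieldTheory.Balaban1983to89.B4Lemma24ZeroBoxAlphaNeg

/-!
# `Balaban1983to89.B4Lemma24ZeroBoxAlphaNegMesh` — B4 Lemma 2.4 AS TYPED (`B4.Lemma24Printed`): the literal Hölder
range «α<1» of the typed leaf FAILS AT EVERY FIXED SCALE `j` (mesh `n = L^j`, `j ≥ 0` arbitrary) of the zero-field
box family of `B4Lemma24ZeroBoxScale` — a kernel refutation of the typed (2.36) clause for EVERY `α < 0` on the
mesh-`n` sub-family `meshFam … n`, for EVERY `n ≥ 1` (hypothesis-free), by a mass/decay argument that does not use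
the unit-mesh minimum principle; hence `¬ B4.Lemma24Printed (meshFam … n)` for every `n ≥ 1` and, by restriction to
mesh 1, a second proof of node 22's `¬ Bound236 (zeroFieldScales …) δ₀ α` (a leaf importing `B4Lemma24ZeroBoxAlphaNeg`
— hence `B4Lemma24ZeroBoxScale` — only; no existing module is touched; nothing of B4 is asserted)

Source under audit (cell pub-balaban): T. Bałaban, *Regularity and decay of lattice Green's functions*, Commun. Math.
Phys. **89** (1983) 571–597 [`Balaban1983RegularityDecay`, "B4"], p. 582 [PDF 12] Lemma 2.4 (2.35)–(2.37), p. 577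
[PDF 7] the Hölder norms (2.14), p. 586 [PDF 16] (2.51) (journal page = PDF page + 570; renders
`b2b-balaban-ref1/pages/1983-cmp89-regularity-decay/1983-cmp89-regularity-decay-p012-x2.png`, `-p007-x2.png`,
`-p016-x2.png`, read as images).

## WHAT IS PRINTED (verbatim; `≦` of the print written `≤`)

p. 582: «Lemma 2.4. There exist positive constants c₀, δ₀, and for α<1, there exists a constant c₁, such that
|(G_j(□)Q_j^*)(x, y)|, |(∂_μ^{L^{−j}} G_j(□)Q_j^*)(x, y)| ≤ c₀e^{−δ₀|x−y|},   (2.35)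
(1/|x−x′|^α) |(∂_μ^{L^{−j}} G_j(□)Q_j^*)(x, y) − (∂_μ^{L^{−j}} G_j(□)Q_j^*)(x′, y)| ≤ c₁e^{−δ₀ dist({x,x′},y)},   (2.36)
|C^{(j)}(□; y, y′)| ≤ c₀e^{−δ₀|y−y′|},   (2.37)
for arbitrary non-negative integer j, arbitrary, rectangular parallelepiped □ ⊂ L^{−j}Z^d built of large blocks, and
x, x′ ∈ □, y, y′ ∈ □^{(j)} = □∩Z^d.»

p. 577: «We will need Hölder norms:
‖f‖_{1,α} = max{sup_x |f(x)|, sup_{x,μ} |(D^η_{A,μ}f)(x)|, sup_{x,x′,μ} (1/|x′ − x|^α)|U(A(Γ_{x,x′}))·(D^η_{A,μ}f)(x′) −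
(D^η_{A,μ}f)(x)|},   (2.14)  where the suprema are taken on a domain of the function f.»

p. 586 (end of the proof of Lemma 2.4): «≤ O(1), the constant depends on α<1.   (2.51)».

## THE TYPED LEAF (tree, `B4.lean`; verbatim) AND THE CLAUSE REFUTED HERE

`B4.Lemma24Printed (fam : I → B4.ScaleSetting) : Prop := ∃ c₀ δ₀ : ℝ, 0 < c₀ ∧ 0 < δ₀ ∧ (∀ i : I, (fam i).rectLarge →
(∀ x y, (fam i).kerGQ x y ≤ c₀ * Real.exp (-(δ₀ * (fam i).distF x y))) ∧ (∀ μ x y, (fam i).kerDGQ μ x y ≤ c₀ * Real.exp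
(-(δ₀ * (fam i).distF x y))) ∧ (∀ y y', (fam i).kerC y y' ≤ c₀ * Real.exp (-(δ₀ * (fam i).distU y y')))) ∧ (∀ α : ℝ,
α < 1 → ∃ c₁ : ℝ, 0 < c₁ ∧ ∀ i : I, (fam i).rectLarge → ∀ μ x x' y, (fam i).lhs236 α μ x x' y ≤ c₁ * Real.exp (-(δ₀ *
(fam i).dist2F x x' y)))` — the second conjunct carries the LITERAL binder `∀ α : ℝ, α < 1 →` with NO lower bound on
`α`.  Node 21 (`B4Lemma24ZeroBoxScale`) names the second conjunct at one `α` `Bound236 fam δ₀ α`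
(`lemma24Printed_iff` is `Iff.rfl`) and builds the zero-field box family `zeroFieldScales d ℓ a₋ a₊ m²₊ a₂₋ a₂₊ :
ScaleIdx … → B4.ScaleSetting` (every mesh `n ≥ 1`, every box of `L`-blocks, constants in the window); node 22
(`B4Lemma24ZeroBoxAlphaNeg`) refutes `Bound236 (zeroFieldScales …) δ₀ α` for `α < 0` through the MESH-1 members
(`n = 1 = L⁰`, where the box operator is a Z-matrix and the minimum principle applies), recording (HONEST SCOPE (b)
there) that for meshes `n ≥ 2` the failure «is expected but is NOT certified».  This file certifies it at EVERY mesh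
`n ≥ 1`, on the sub-family `meshFam d ℓ a₋ a₊ m²₊ a₂₋ a₂₊ n = zeroFieldScales … ∘ Subtype.val` of the members with
`i.n = n` (§4) — so no restriction of the scale index to `j ≥ 1` (or to any fixed `j`) rescues the literal binder.

## WHAT THIS FILE CERTIFIES (kernel-checked, zero `sorry`, no hypothesis; HONEST SCOPE below)

* §1 THE BLOCK COLUMN `u(x) = (G_j(□)Q_j^*)(x, 0) = Σ_{blk x′ = 0} Gᴿ(x,x′)` of the REAL box Green function
  `Gᴿ = (boxOpR n a m² M)⁻¹` of b04 (`uB`; `uB_eq_mulVec`: `u = Gᴿ·1_{B(0)}`) and its TOTAL MASS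
  `(m² + a)·Σ_x u(x) = n^{d+1}` (`uB_mass`): the box operator `−Δ^N + m² + aQ*Q` is symmetric with constant row sums
  `m² + a` (`boxOpR_mulVec_one`, every block has `n^{d+1}` points, `card_boxBlk`), so `Σ_x (A v)(x) = (m²+a)Σ_x v(x)`
  (`sum_boxOpR_mulVec`) and `A u = 1_{B(0)}` (`boxOpR_mulVec_uB`).
* §2 THE DECAY OF THE BLOCK COLUMN, UNIFORM IN THE BOX (`uB_decay`): `|u(x)| ≤ C·e^{−(κ/n)|x|_∞}` for every mesh
  `n ≥ 1`, all constants of the window, every box — the tree's kernel-proved (2.35) for the complex box propagator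
  (`B4Green242Bridge.greenBoxQ_decay_235_inv`, through b04's `boxOp_inv_eq_map`: the complex entries are the real
  ones, `uB_cast`) transported from the block label to the fine point (node 21's `fdist_le_blk`, `exp_transport`);
  the lattice sum `Σ_v e^{−c|v|_∞}` dominates every box sum (`sum_box_exp_le_tsum`,
  `B4Reflection242.summable_exp_supNorm_sub`).
* §3 counting and pigeonholing: `#{x ∈ □ : all coordinates < K} ≤ K^{d+1}` (`card_near_le`), a telescoping pigeonhole
  (`exists_step_le`: `f(K) − f(0) ≤ −D` forces a step `≤ −D/K`), the integer thresholds `natAbove`; node 22's far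
  scale `farT` (`t^{−α} ≥ 4c₁/c` for `t ≥ farT c₁ c α`, `farT_spec`, `α < 0`) and `supNorm_single` are imported.
* §4 THE MESH-`n` MEMBERS `meshIdx … N′` (mesh `n`, `a_j = a₋`, `m_j² = 0`, `a = a₂₋`, the cube of `N′` `L`-blocks per
  side) and THE SUB-FAMILY `meshFam … n` of all members with `i.n = n` (`meshFam_eq_comp`; `bound236_comp`: (2.36)
  for a family gives (2.36) for every sub-family); THE VALUE OF THE TYPED (2.36) QUANTITY of a mesh-`n` member at
  direction `μ`, base point `x`, far point `x′ = x + t·e_μ` (`t ≥ 1`), unit point `y = 0`, when `x + e_μ, x′ + e_μ ∈ □`: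
  `lhs236 α μ x x′ 0 = (n/t)^α · (n·|(u(x′+e_μ) − u(x′)) − (u(x+e_μ) − u(x))|)` (`member_lhs236`) and
  `0 ≤ dist2F x x′ 0 ≤ |x|_∞/n` (`member_dist2F`).
* §5 **`not_bound236_meshFam`**: for every `d`, `ℓ`, every window `0 < a₋ ≤ a₊`, `m²₊ ≥ 0`, `a₂₋ ≤ a₂₊`, EVERY mesh
  `n ≥ 1`, every `α < 0` and EVERY `δ₀ ∈ ℝ`: `¬ Bound236 (meshFam d ℓ a₋ a₊ m²₊ a₂₋ a₂₊ n) δ₀ α`.  MECHANISM (all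
  constants chosen before the box, from `c₁, α, δ₀, n, d, a₋` and the decay constants `κ, C` of §2): with `r = κ/n`,
  `T = Σ_v e^{−(r/2)|v|_∞}`, `M₀ = n^{d+1}/a₋`, take `K > 4CT/((r/2)M₀)` — the far part `{|x|_∞ ≥ K}` of the mass is
  `≤ Ce^{−(r/2)K}·T ≤ M₀/4`, so the `≤ K^{d+1}` near points carry `≥ 3M₀/4` and one of them, `x₁`, has
  `u(x₁) ≥ c′ = M₀/(4K^{d+1})`; take `K₁ > 2C/(r c′)` — at `x₁ + K₁e₀` the decay gives `u ≤ c′/2`, so some bond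
  `x = x₁ + ke₀`, `k < K₁`, has `u(x+e₀) − u(x) ≤ −c″`, `c″ = c′/(2K₁)`; take `K₂ > 4C/(r c″)`,
  `B = c₁e^{|δ₀|(K+K₁)}`, `t₀ = farT B (n c″) α + K₂`, the far shift `P = n·t₀` fine steps and the cube of
  `N′ = K + K₁ + P + 2` blocks per side: at `x′ = x + Pe₀` both `|u(x′)|, |u(x′+e₀)| ≤ c″/4`, so the bracket is
  `≥ n·c″/2`, the weight is `(n/P)^α = t₀^{−α} ≥ 4B/(n c″)` and the left side of the typed (2.36) is `≥ 2B`, while its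
  right side is `c₁e^{−δ₀·dist2F} ≤ c₁e^{|δ₀|(K+K₁)} = B` (`dist2F ≤ |x|_∞/n ≤ K + K₁`) — contradiction.  Hence
  **`not_bound236_scale`** (`n = (ℓ+1)^j`, every `j : ℕ`), **`not_lemma24Printed_meshFam : ¬ B4.Lemma24Printed
  (meshFam … n)`** for every `n ≥ 1` (instance `α = −1` of the second conjunct); node 22's
  `not_bound236_zeroFieldScales` (`¬ Bound236 (zeroFieldScales d ℓ a₋ a₊ m²₊ a₂₋ a₂₊) δ₀ α` for `α < 0`) follows again
  by restriction to `meshFam … 1` (`bound236_comp`) — a second proof WITHOUT the minimum principle, recorded as an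
  `example` in §6 (the theorem itself is node 22's and is not restated).
* §6 non-vacuity on node 21's concrete window `(d+1, L, a₋, a₊, m²₊, a₂₋, a₂₊) = (4, 2, 1/2, 2, 1, 1/2, 2)`: at scale
  `j = 1` (mesh 2) `Bound236 … 0 (−1/2)` fails, the leaf fails on `meshFam … (2^j)` for every `j`, and the scale-5
  sub-family is inhabited.

## HONEST SCOPE

(a) This is a statement about the TYPED TRANSCRIPTION `B4.Lemma24Printed`, not against B4's Lemma 2.4 as its proof
reads it: the print's «for α<1» names the exponent of the HÖLDER norm (2.14) (p. 577), and B4 PRINTS NO LOWER BOUND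
for `α` anywhere (only «α<1»: p. 573 Theorem, p. 577 (2.14), p. 582 Lemma 2.4, p. 586 (2.51)); `0 ≤ α` is used TACITLY
in the proof (p. 582, the first term of (2.39); p. 585, the last display
`(1/|x−x′|^α)|e^{i(p′+l)·(x−x′)} − 1| ≦ O(1)|p′+l|^α`, which fails for `α < 0`), and `α < 1` is what makes the
geometric sums `Σ_j (L^jη)^{1−α}` of (2.39) and the bound (2.51) converge. For `α < 0` the weight
`1/|x − x′|^α = |x − x′|^{|α|}` GROWS with the separation and (2.36) is no regularity statement; read literally, with
`c₁` independent of the (arbitrary) box, it fails for the free block-averaged Neumann Green function of a large cube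
at zero field, in every dimension and at every scale, as certified here. The natural repair of the typed leaf — NOT
made here (b04 owns `B4.lean`) — is the binder pair `0 ≤ α → α < 1 →`, i.e. node 21's `Lemma24PrintedNN`, which node
21 discharges on `zeroFieldScales`; with that tacit lower bound read into «for α<1» nothing printed is contradicted,
without it the printed sentence shares the defect of its faithful transcription. DOWNSTREAM (v1.1, corrected after the
independent cross-read of node 22 `B4Lemma24ZeroBoxAlphaNeg` by b2b-balaban-pv06-g24): the consumers
`B5FromB4.prop12_of_B4` and `B5Ineq110Gp.leafGp_of_lemma24` use the first conjunct only, BUT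
`B5Ineq113.h113_of_display136` destructures the leaf and USES the (2.36) conjunct (`H236 α hα` for every `α < 1` ↦
`leaf236_of_lemma24` ↦ `Leaf236` ↦ `ineq113At_of_display136`), consuming it only at `0 ≤ α < 1` (`hα0` in scope
there); so the repair `0 ≤ α →` is compatible with every consumer but is not a one-token change (`B5Ineq113` must be
co-patched — b04's and b05's call), and, as typed today, every chain theorem with a binder
`h24 : B4.Lemma24Printed fam₂₄` is uninstantiable with `fam₂₄ :=` node 21's family or with any fixed-mesh slice
`meshFam … n` of it (this file).
(b) What is new relative to node 22: the refutation holds on EACH fixed-mesh sub-family `meshFam … n`, `n ≥ 1`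
arbitrary — in the print's terms at each fixed scale `j` (`n = L^j`), not only at `j = 0` — so the defect is not an
artefact of admitting the unit mesh into node 21's index window.  The argument replaces node 22's minimum principle
(unavailable for `n ≥ 2`: `a_jQ_j^*Q_j` has positive off-diagonal entries) by two box-uniform facts: the exact total
mass `n^{d+1}/a_j` of the block column (symmetry + constant row sums of (2.44) at `A = 0`) and the tree's (2.35)
decay.  The mass grows like `n^{d+1}` and the decay rate is `κ/n`, so all constants depend on `n` (as they may: `n`
is fixed before `c₁` is tested against boxes); nothing is uniform in `n → ∞` or in `α ↑ 0`, and nothing is claimed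
about (2.36) with box-dependent constants.
(c) Conventions are node 21's (HONEST SCOPE (b), (c) there): sup norms, `A = 0`, one component, Neumann boxes anchored
at the origin, mesh-`n` fine lattice `□ = Π[0, n·L·M′_μ)` with unit points `blk`, the guard of `lhs236` (both forward
neighbours in `□`, `x ≠ x′`) — the refuting configuration satisfies the guard (`x + e₀`, `x′ + e₀ ∈ □` by the choice
`N′ = K + K₁ + P + 2`, `x′ − x = P·e₀ ≠ 0`), so the certified value is the printed quantity, not the conventional `0`.
(d) `δ₀` is arbitrary (any sign); the decay distance of the refuting configuration is NOT zero here (the base point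
`x` is found by pigeonholing, `|x|_∞ ≤ K + K₁`), which is why the far scale is chosen after `B = c₁e^{|δ₀|(K+K₁)}`.
The positivity of `c₀` and the first conjunct of the leaf play no role (only the tree's PROVED (2.35) is used, as a
theorem, in §2).
(e) Value = kernel certificate of a TYPING DEFECT of the cell's leaf `B4.Lemma24Printed` (the literal Hölder range) at
every scale of node 21's family, closing the gap left open in node 22's HONEST SCOPE (b) (and giving a second proof,
by a different mechanism, of node 22's theorem); negative knowledge for b04 / the carver; NOT summit progress and NOT
a claim against B4.

## DICTIONARY (print ↦ Lean; node 21's, all at `A = 0`, one component)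

scale `j`, `ξ = L^{−j}` ↦ mesh `i.n = n` (`meshIdx`, `n = (ℓ+1)^j` in `not_bound236_scale`); `□` ↦ the cube
`boxDom (fun _ ↦ n·(L·N′))` of fine points, `□^{(j)}` ↦ `boxDom (fun _ ↦ L·N′)` (unit points = block labels `blk n`);
`G_j(□)` ↦ `(boxOp n a₋ 0 M)⁻¹ = ((boxOpR n a₋ 0 M)⁻¹).map (↑)` (b04's `boxOp_inv_eq_map`); `(G_j(□)Q_j^*)(x, 0)` ↦ the
block sum `uB n a₋ 0 M x = Σ_{blk x′ = 0} Gᴿ(x,x′)`; `∂^ξ_μ` ↦ `n·`(forward fine difference); `1/|x − x′|^α` ↦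
`(n/|x′ − x|_∞)^α` (`Real.rpow`); `dist({x,x′},y)` ↦ `min (fdist n x y) (fdist n x′ y)`; the rest as in
`B4Lemma24ZeroBoxScale`.

DEPENDENCIES (kernel-proved tree modules only; no Literature fact is minted, no hypothesis is assumed): node 22
`B4Lemma24ZeroBoxAlphaNeg` (only the elementary `supNorm_single`, `farT`, `farT_spec`; its theorem
`not_bound236_zeroFieldScales` is used nowhere in the proofs), node 21 `B4Lemma24ZeroBoxScale` (`ScaleIdx`,
`zeroFieldScales`, `Bound236`, `lemma24Printed_iff`, `fdist`, `fdist_nonneg`, `fdist_le_blk`, `exp_transport`),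
b04's `B4` (`Lemma24Printed`, `ScaleSetting`), `B4BoxCov237` (`opBoxR`, `boxOpR`, `opBoxR_mulVec`, `boxOpR_isSymm`,
`boxOpR_mul_inv`, `boxOpR_inv_isSymm`, `boxOp_inv_eq_map`, `sum_boxNbrs_commR`, `card_filter_blk`),
`B4Green242Bridge` (`boxOp`, `boxNbrs`, `boxBlk`, `zero_mem_boxDom`, `greenBoxQ_decay_235_inv`),
`B4Reflection242` (`boxDom`, `mem_boxDom`, `blk`, `blk_mem_boxDom`, `supNorm_le_of_forall`,
`summable_exp_supNorm_sub`), `B4ContourShift` (`supNorm`, `abs_le_supNorm`, `supNorm_nonneg`); Mathlib otherwise.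

PROVENANCE: this node (pv17 node 23); all proofs are this file's.  Axioms: `propext`, `Classical.choice`, `Quot.sound`
only. VERSIONS: v1 p192585 (commit adb0c4cbe9ec); v1.1 (this file) = DOCFIX of HONEST SCOPE (a) after the independent
cross-read of node 22 by b2b-balaban-pv06-g24 (its D-1: no lower bound for `α` is printed — the tacit `0 ≤ α` is now
located instead of attributed to (2.14); its D-2: the downstream use of the (2.36) conjunct in
`B5Ineq113.h113_of_display136` is now recorded); no declaration, statement, proof or tag changed — everything from the
`namespace` line on is byte-identical to v1.
-/

namespace Literature.MathematicalPhysics.QuantumFieldTheory.Balaban1983to89.B4Lemma24ZeroBoxAlphaNegMesh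

open Finset Matrix
open Literature.MathematicalPhysics.QuantumFieldTheory.Balaban1983to89
open Literature.MathematicalPhysics.QuantumFieldTheory.Balaban1983to89.B4ContourShift
open Literature.MathematicalPhysics.QuantumFieldTheory.Balaban1983to89.B4Reflection242
open Literature.MathematicalPhysics.QuantumFieldTheory.Balaban1983to89.B4Green242Bridge
open Literature.MathematicalPhysics.QuantumFieldTheory.Balaban1983to89.B4BoxCov237
open Literature.MathematicalPhysics.QuantumFieldTheory.Balaban1983to89.B4Lemma24ZeroBoxScale

noncomputable section

variable {d : ℕ}

/-! ## §1  The block column of the real Neumann box Green function at mesh `n` and its total mass -/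

/-- the block column `u(x) = (G_j(□)Q_j^*)(x,0) = Σ_{blk x′ = 0} Gᴿ(x,x′)` of the REAL box Green function
`Gᴿ = (boxOpR n a m² M)⁻¹` (source = the corner unit point `y = 0`). [folklore] -/
def uB (n : ℕ) (a m2 : ℝ) (M : Fin (d + 1) → ℕ) (x : ↥(boxDom (fun j => n * M j))) : ℝ :=
  ∑ x' : ↥(boxDom (fun j => n * M j)), if blk n x'.1 = 0 then (boxOpR n a m2 M)⁻¹ x x' else 0

/-- the indicator of the corner block `{blk = 0}`. [folklore] -/
def indB0 (n : ℕ) (M : Fin (d + 1) → ℕ) (x : ↥(boxDom (fun j => n * M j))) : ℝ :=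
  if blk n x.1 = 0 then 1 else 0

/-- `u = Gᴿ·1_{B(0)}`. [folklore] -/
theorem uB_eq_mulVec (n : ℕ) (a m2 : ℝ) (M : Fin (d + 1) → ℕ) :
    uB n a m2 M = (boxOpR n a m2 M)⁻¹ *ᵥ indB0 n M := by
  funext x
  simp only [uB, indB0, Matrix.mulVec, dotProduct, mul_ite, mul_one, mul_zero]

/-- `(−Δ^N + m² + aQ*Q)·u = 1_{B(0)}`. [folklore] -/
theorem boxOpR_mulVec_uB {n : ℕ} (hn : 1 ≤ n) {a m2 : ℝ} (ha : 0 < a) (hm : 0 ≤ m2)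
    {M : Fin (d + 1) → ℕ} (hM : ∀ i, 1 ≤ M i) :
    boxOpR n a m2 M *ᵥ uB n a m2 M = indB0 n M := by
  rw [uB_eq_mulVec, Matrix.mulVec_mulVec, boxOpR_mul_inv hn ha hm hM, Matrix.one_mulVec]

/-- every block of the box `□ = Π[0, n·M_μ)` has `n^{d+1}` fine points. [folklore] -/
theorem card_boxBlk {n : ℕ} (hn : 1 ≤ n) (M : Fin (d + 1) → ℕ) (x : ↥(boxDom (fun j => n * M j))) :
    (boxBlk n (fun j => n * M j) x).card = n ^ (d + 1) := by
  have hb : blk n x.1 ∈ boxDom M := blk_mem_boxDom hn x.2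
  exact card_filter_blk hn M ⟨blk n x.1, hb⟩

/-- the ROW SUMS of the box operator are the constant `m² + a`: `(−Δ^N)1 = 0` and `(aQ*Q 1)(x) = a·n^{−(d+1)}·#B(x)
= a`. [folklore] -/
theorem boxOpR_mulVec_one {n : ℕ} (hn : 1 ≤ n) (a m2 : ℝ) (M : Fin (d + 1) → ℕ)
    (x : ↥(boxDom (fun j => n * M j))) :
    (boxOpR n a m2 M *ᵥ fun _ => (1 : ℝ)) x = m2 + a := by
  have hn0 : (n : ℝ) ≠ 0 := by exact_mod_cast (show n ≠ 0 by omega)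
  unfold boxOpR
  rw [opBoxR_mulVec]
  simp only [sub_self, Finset.sum_const_zero, mul_zero, zero_add, mul_one, Finset.sum_const, nsmul_eq_mul]
  rw [card_boxBlk hn M x]
  push_cast
  field_simp

/-- `Σ_x (A v)(x) = Σ_x (A 1)(x)·v(x)` for the SYMMETRIC box operator `A`. [folklore] -/
theorem sum_boxOpR_mulVec (n : ℕ) (a m2 : ℝ) (M : Fin (d + 1) → ℕ) (v : ↥(boxDom (fun j => n * M j)) → ℝ) :
    ∑ x, (boxOpR n a m2 M *ᵥ v) x = ∑ x, (boxOpR n a m2 M *ᵥ fun _ => (1 : ℝ)) x * v x := by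
  simp only [Matrix.mulVec, dotProduct, mul_one]
  rw [Finset.sum_comm]
  refine Finset.sum_congr rfl fun z _ => ?_
  rw [Finset.sum_mul]
  refine Finset.sum_congr rfl fun x _ => ?_
  rw [(boxOpR_isSymm n a m2 M).apply x z]

/-- **TOTAL MASS OF THE BLOCK COLUMN**: `(m² + a)·Σ_{x ∈ □} u(x) = n^{d+1}` (sum the equation `A u = 1_{B(0)}` over
the box and use the constant column sums `m² + a` of the symmetric `A`). [folklore] -/
theorem uB_mass {n : ℕ} (hn : 1 ≤ n) {a m2 : ℝ} (ha : 0 < a) (hm : 0 ≤ m2)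
    {M : Fin (d + 1) → ℕ} (hM : ∀ i, 1 ≤ M i) :
    (m2 + a) * ∑ x, uB n a m2 M x = (n : ℝ) ^ (d + 1) := by
  have h1 : ∑ x, (boxOpR n a m2 M *ᵥ uB n a m2 M) x = (n : ℝ) ^ (d + 1) := by
    rw [boxOpR_mulVec_uB hn ha hm hM]
    simp only [indB0]
    rw [Finset.sum_boole]
    have hc := card_filter_blk hn M ⟨0, zero_mem_boxDom hM⟩
    exact_mod_cast hc
  rw [sum_boxOpR_mulVec] at h1
  simp only [boxOpR_mulVec_one hn] at h1
  rw [← Finset.mul_sum] at h1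
  exact h1

/-! ## §2  Exponential decay of the block column in the fine sup-norm (from the tree's (2.35)) -/

/-- the complex block column of the tree's `(boxOp …)⁻¹` is the real one. [folklore] -/
theorem uB_cast {n : ℕ} (hn : 1 ≤ n) {a m2 : ℝ} (ha : 0 < a) (hm : 0 ≤ m2)
    {M : Fin (d + 1) → ℕ} (hM : ∀ i, 1 ≤ M i) (x : ↥(boxDom (fun j => n * M j))) :
    (∑ x' : ↥(boxDom (fun j => n * M j)), (if blk n x'.1 = 0 then (boxOp n a m2 M)⁻¹ x x' else 0))
      = ((uB n a m2 M x : ℝ) : ℂ) := by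
  rw [boxOp_inv_eq_map hn ha hm hM, uB, Complex.ofReal_sum]
  refine Finset.sum_congr rfl fun x' _ => ?_
  split_ifs with h
  · rw [Matrix.map_apply]
  · rw [Complex.ofReal_zero]

/-- `|ξx − 0|_∞ = |x|_∞/n`. [folklore] -/
theorem fdist_zero (n : ℕ) (x : Fin (d + 1) → ℤ) : fdist n x 0 = supNorm x / n := by
  have e : (x - fun i => (n : ℤ) * (0 : Fin (d + 1) → ℤ) i) = x := by
    funext i
    simp
  unfold fdist
  rw [e]

/-- **DECAY OF THE BLOCK COLUMN, UNIFORM IN THE BOX** (the tree's (2.35) for `G_j(□)Q_j^*`, transported from the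
block label to the fine point): `|u(x)| ≤ C′·e^{−(κ/n)|x|_∞}` for every mesh `n ≥ 1`, every constant in the window,
every box. [cite: Balaban1983RegularityDecay, p. 582 Lemma 2.4 (2.35); tree
`B4Green242Bridge.greenBoxQ_decay_235_inv`] -/
theorem uB_decay (d : ℕ) (aminus aplus m2plus : ℝ) (ha : 0 < aminus) :
    ∃ κ C : ℝ, 0 < κ ∧ 0 ≤ C ∧ ∀ (n : ℕ), 1 ≤ n → ∀ (a m2 : ℝ), aminus ≤ a → a ≤ aplus → 0 ≤ m2 → m2 ≤ m2plus →
      ∀ (M : Fin (d + 1) → ℕ), (∀ i, 1 ≤ M i) → ∀ x : ↥(boxDom (fun j => n * M j)),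
        |uB n a m2 M x| ≤ C * Real.exp (-(κ / n * supNorm x.1)) := by
  obtain ⟨κ, C, hκ, hC, H⟩ := greenBoxQ_decay_235_inv d aminus aplus m2plus ha
  refine ⟨κ, C * Real.exp κ, hκ, by positivity, fun n hn a m2 h1 h2 h3 h4 M hM x => ?_⟩
  obtain ⟨-, hdec⟩ := H n hn a m2 h1 h2 h3 h4 M hM
  have hb := hdec x 0 (zero_mem_boxDom hM)
  rw [uB_cast hn (lt_of_lt_of_le ha h1) h3 hM x, Complex.norm_real, Real.norm_eq_abs, sub_zero] at hb
  have hfd : fdist n x.1 0 ≤ supNorm (blk n x.1 - 0) + 1 := fdist_le_blk hn x.1 0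
  rw [sub_zero] at hfd
  have ht := exp_transport hC hκ.le hfd
  rw [fdist_zero, show κ * (supNorm x.1 / n) = κ / n * supNorm x.1 by ring] at ht
  exact hb.trans ht

/-- a finite box sum of `e^{−c|x|_∞}` is bounded by the lattice sum (box-independent). [folklore] -/
theorem sum_box_exp_le_tsum {c : ℝ} (hc : 0 < c) (N : Fin (d + 1) → ℕ) :
    ∑ x : ↥(boxDom N), Real.exp (-(c * supNorm x.1))
      ≤ ∑' v : Fin (d + 1) → ℤ, Real.exp (-(c * supNorm v)) := by
  have hs : Summable (fun v : Fin (d + 1) → ℤ => Real.exp (-(c * supNorm v))) := by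
    have h := summable_exp_supNorm_sub hc (0 : Fin (d + 1) → ℤ)
    simpa only [sub_zero] using h
  rw [Finset.sum_coe_sort (boxDom N) (fun v => Real.exp (-(c * supNorm v)))]
  exact hs.sum_le_tsum _ (fun v _ => (Real.exp_pos _).le)

/-- the lattice sum is non-negative. [folklore] -/
theorem tsum_exp_nonneg (c : ℝ) : 0 ≤ ∑' v : Fin (d + 1) → ℤ, Real.exp (-(c * supNorm v)) :=
  tsum_nonneg fun _ => (Real.exp_pos _).le

/-! ## §3  Counting and pigeonholing -/

/-- the near region `{x ∈ □ : x_i < K ∀ i}` has at most `K^{d+1}` points. [folklore] -/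
theorem card_near_le (N : Fin (d + 1) → ℕ) (K : ℕ) :
    (Finset.univ.filter (fun x : ↥(boxDom N) => ∀ i, x.1 i < K)).card ≤ K ^ (d + 1) := by
  classical
  have hK : (boxDom (fun _ : Fin (d + 1) => K)).card = K ^ (d + 1) := by
    unfold boxDom
    rw [Fintype.card_piFinset]
    simp only [Int.card_Ico, sub_zero, Int.toNat_natCast, Finset.prod_const, Finset.card_univ, Fintype.card_fin]
  rw [← hK]
  refine Finset.card_le_card_of_injOn (fun x => x.1) (fun x hx => ?_) (Subtype.val_injective.injOn)
  simp only [Finset.coe_filter, Finset.mem_univ, true_and, Set.mem_setOf_eq] at hx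
  rw [Finset.mem_coe, mem_boxDom]
  exact fun i => ⟨(mem_boxDom.1 x.2 i).1, hx i⟩

/-- outside the near region the sup-norm is at least `K`. [folklore] -/
theorem supNorm_ge_of_not_near {N : Fin (d + 1) → ℕ} {K : ℕ} (x : ↥(boxDom N)) (h : ¬ ∀ i, x.1 i < K) :
    (K : ℝ) ≤ supNorm x.1 := by
  push Not at h
  obtain ⟨i, hi⟩ := h
  have h0 := (mem_boxDom.1 x.2 i).1
  have h1 : ((|x.1 i| : ℤ) : ℝ) ≤ supNorm x.1 := abs_le_supNorm x.1 i
  rw [abs_of_nonneg h0] at h1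
  have h2 : (K : ℝ) ≤ ((x.1 i : ℤ) : ℝ) := by exact_mod_cast hi
  exact h2.trans h1

/-- inside the near region the sup-norm is below `K`. [folklore] -/
theorem supNorm_le_of_near {N : Fin (d + 1) → ℕ} {K : ℕ} (x : ↥(boxDom N)) (h : ∀ i, x.1 i < K) :
    supNorm x.1 ≤ K := by
  apply supNorm_le_of_forall
  intro i
  have h0 := (mem_boxDom.1 x.2 i).1
  rw [abs_of_nonneg h0]
  exact_mod_cast (h i).le

/-- pigeonhole on a telescoping sum: a total drop of at least `D` over `K` steps has a step dropping by at least
`D/K`. [folklore] -/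
theorem exists_step_le {f : ℕ → ℝ} {K : ℕ} (hK : 1 ≤ K) {D : ℝ} (h : f K - f 0 ≤ -D) :
    ∃ k, k < K ∧ f (k + 1) - f k ≤ -(D / K) := by
  by_contra hne
  push Not at hne
  have hsum : ∑ k ∈ Finset.range K, (f (k + 1) - f k) = f K - f 0 := Finset.sum_range_sub f K
  have hlt : ∑ k ∈ Finset.range K, (-(D / K)) < ∑ k ∈ Finset.range K, (f (k + 1) - f k) :=
    Finset.sum_lt_sum_of_nonempty (Finset.nonempty_range_iff.2 (by omega))
      fun k hk => hne k (Finset.mem_range.1 hk)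
  rw [Finset.sum_const, Finset.card_range, nsmul_eq_mul, hsum] at hlt
  have hK0 : (0 : ℝ) < K := by exact_mod_cast hK
  have e : (K : ℝ) * -(D / K) = -D := by field_simp
  linarith

/-- a natural number above a real. [folklore] -/
def natAbove (q : ℝ) : ℕ := ⌈q⌉₊ + 1

/-- `q < natAbove q`. [folklore] -/
theorem lt_natAbove (q : ℝ) : q < natAbove q := by
  unfold natAbove
  push_cast
  linarith [Nat.le_ceil q]

/-- `1 ≤ natAbove q`. [folklore] -/
theorem one_le_natAbove (q : ℝ) : 1 ≤ natAbove q := Nat.le_add_left 1 _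

/-- moving `m` steps along the axis `μ` stays in the cube while the coordinate stays below the side. [folklore] -/
theorem add_single_mem_cube {S : ℕ} {z : Fin (d + 1) → ℤ} (hz : z ∈ boxDom (fun _ : Fin (d + 1) => S))
    (μ : Fin (d + 1)) {m : ℕ} (hm : z μ + m < S) :
    z + Pi.single μ (m : ℤ) ∈ boxDom (fun _ : Fin (d + 1) => S) := by
  rw [mem_boxDom] at hz ⊢
  intro j
  by_cases hj : j = μ
  · subst hj
    rw [Pi.add_apply, Pi.single_eq_same]
    exact ⟨by linarith [(hz j).1, (m.cast_nonneg : (0 : ℤ) ≤ m)], hm⟩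
  · rw [Pi.add_apply, Pi.single_eq_of_ne hj, add_zero]
    exact hz j

/-- decay beyond a threshold: `C e^{−rs} ≤ C/(r s₀)` for `s ≥ s₀ > 0`. [folklore] -/
theorem decay_far {C r s s₀ : ℝ} (hC : 0 ≤ C) (hr : 0 < r) (hs₀ : 0 < s₀) (hs : s₀ ≤ s) :
    C * Real.exp (-(r * s)) ≤ C / (r * s₀) := by
  have h1 : Real.exp (-(r * s)) ≤ Real.exp (-(r * s₀)) := Real.exp_le_exp.2 (by nlinarith)
  have h2 : Real.exp (-(r * s₀)) ≤ 1 / (r * s₀) := by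
    rw [Real.exp_neg, ← one_div]
    exact one_div_le_one_div_of_le (by positivity) (by linarith [Real.add_one_le_exp (r * s₀)])
  calc C * Real.exp (-(r * s)) ≤ C * (1 / (r * s₀)) := mul_le_mul_of_nonneg_left (h1.trans h2) hC
    _ = C / (r * s₀) := by ring

/-- the threshold arithmetic: `mC/(rc) < k` gives `C/(rk) ≤ c/m`. [folklore] -/
theorem thresh {C r c m : ℝ} {k : ℕ} (hr : 0 < r) (hc : 0 < c) (hm : 0 < m) (hk : 1 ≤ k)
    (hq : m * C / (r * c) < k) : C / (r * k) ≤ c / m := by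
  have hk0 : (0 : ℝ) < k := by exact_mod_cast hk
  rw [div_lt_iff₀ (by positivity)] at hq
  rw [div_le_iff₀ (by positivity), div_mul_eq_mul_div, le_div_iff₀ hm]
  nlinarith

/-! ## §4  The mesh-`n` members of the zero-field box family and the typed (2.36) quantity on them -/

section Member

variable {ℓ : ℕ} {aminus aplus m2plus a2minus a2plus : ℝ}

/-- THE MESH-`n` CUBE MEMBER of the index window: mesh `n ≥ 1` (`n = L^j` for the printed scale `j`), `a_j = a₋`,
`m_j² = 0`, `a = a₂₋`, the cube of `N′` `L`-blocks per side (fine side `n·L·N′`). [folklore] -/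
def meshIdx (d ℓ : ℕ) {aminus aplus m2plus a2minus a2plus : ℝ} {n : ℕ} (hn : 1 ≤ n) (ha' : aminus ≤ aplus)
    (hm2 : 0 ≤ m2plus) (ha2 : a2minus ≤ a2plus) (N' : ℕ) (hN' : 1 ≤ N') :
    ScaleIdx d ℓ aminus aplus m2plus a2minus a2plus :=
  ⟨n, hn, aminus, 0, a2minus, le_rfl, ha', le_rfl, hm2, le_rfl, ha2, fun _ => N', fun _ => hN'⟩

/-- **THE SUB-FAMILY OF THE MESH-`n` MEMBERS** of the zero-field box family `zeroFieldScales` (ONE scale `j`,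
`n = L^j`; all constants of the window, all boxes of `L`-blocks). [cite: Balaban1983RegularityDecay, p. 582
Lemma 2.4 «for arbitrary non-negative integer j» — the family at one fixed j; dictionary =
`B4Lemma24ZeroBoxScale.zeroFieldScales`] -/
def meshFam (d ℓ : ℕ) (aminus aplus m2plus a2minus a2plus : ℝ) (n : ℕ) :
    {i : ScaleIdx d ℓ aminus aplus m2plus a2minus a2plus // i.n = n} → B4.ScaleSetting :=
  fun i => zeroFieldScales d ℓ aminus aplus m2plus a2minus a2plus i.1

/-- (2.36) for a family gives (2.36) for every sub-family (same constant). [folklore] -/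
theorem bound236_comp {I J : Type} (fam : I → B4.ScaleSetting) (φ : J → I) {δ₀ α : ℝ}
    (h : Bound236 fam δ₀ α) : Bound236 (fam ∘ φ) δ₀ α := by
  obtain ⟨c₁, hc₁, hB⟩ := h
  exact ⟨c₁, hc₁, fun j hj => hB (φ j) hj⟩

/-- the mesh-`n` sub-family is the restriction of `zeroFieldScales` along `Subtype.val`. [folklore] -/
theorem meshFam_eq_comp (d ℓ : ℕ) (aminus aplus m2plus a2minus a2plus : ℝ) (n : ℕ) :
    meshFam d ℓ aminus aplus m2plus a2minus a2plus n
      = zeroFieldScales d ℓ aminus aplus m2plus a2minus a2plus ∘ Subtype.val := rfl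

/-- the block-column bracket through the cast: `Σ_{blk x″=0} ((Gᶜ(p,x″) − Gᶜ(q,x″)) − (Gᶜ(r,x″) − Gᶜ(s,x″)))
= ↑((u(p) − u(q)) − (u(r) − u(s)))` for `Gᶜ = Gᴿ.map ofReal`. [folklore] -/
theorem sum_blk_bracket (n : ℕ) (a m2 : ℝ) (M : Fin (d + 1) → ℕ) (p q r s : ↥(boxDom (fun j => n * M j))) :
    (∑ x'' : ↥(boxDom (fun j => n * M j)),
        (if blk n x''.1 = 0 then
          ((((boxOpR n a m2 M)⁻¹).map ((↑) : ℝ → ℂ)) p x'' - (((boxOpR n a m2 M)⁻¹).map ((↑) : ℝ → ℂ)) q x'')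
            - ((((boxOpR n a m2 M)⁻¹).map ((↑) : ℝ → ℂ)) r x'' - (((boxOpR n a m2 M)⁻¹).map ((↑) : ℝ → ℂ)) s x'')
        else 0))
      = (((uB n a m2 M p - uB n a m2 M q) - (uB n a m2 M r - uB n a m2 M s) : ℝ) : ℂ) := by
  simp only [uB]
  rw [Complex.ofReal_sub, Complex.ofReal_sub, Complex.ofReal_sub, Complex.ofReal_sum, Complex.ofReal_sum,
    Complex.ofReal_sum, Complex.ofReal_sum, ← Finset.sum_sub_distrib, ← Finset.sum_sub_distrib,
    ← Finset.sum_sub_distrib]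
  refine Finset.sum_congr rfl fun x _ => ?_
  split_ifs <;> simp [Matrix.map_apply]

/-- `x + t·e_μ ≠ x` for `t ≥ 1`. [folklore] -/
theorem add_single_ne (x : Fin (d + 1) → ℤ) (μ : Fin (d + 1)) {t : ℕ} (ht : 1 ≤ t) :
    x + Pi.single μ (t : ℤ) ≠ x := by
  intro h
  have h' := congr_fun h μ
  rw [Pi.add_apply, Pi.single_eq_same] at h'
  omega

/-- **THE TYPED (2.36) QUANTITY ON A MESH-`n` MEMBER** (member `meshIdx`, direction `μ`, base point `x`, far point
`x′ = x + t·e_μ`, unit point `y = 0`): `lhs236 α μ x x′ y = (n/t)^α · n·|(u(x′+e_μ) − u(x′)) − (u(x+e_μ) − u(x))|`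
with `u = G_j(□)Q_j^*(·,0)` the block column of the real Neumann box Green function `(n²(−Δ^N_□) + a₋n^{−(d+1)}Q*Q)⁻¹`
(`m² = 0`) — `(n/|x′−x|_∞)^α = 1/|ξx′ − ξx|_∞^α`, `n·(u(z+e_μ) − u(z)) = (∂^ξ_μ G_j(□)Q_j^*)(z,0)`.
[cite: Balaban1983RegularityDecay, p. 582 Lemma 2.4 (2.36), typed leaf `B4.Lemma24Printed` second conjunct read on
the zero-field box family `B4Lemma24ZeroBoxScale.zeroFieldScales`; dictionary] -/
theorem member_lhs236 (ha : 0 < aminus) (ha' : aminus ≤ aplus) (hm2 : 0 ≤ m2plus) (ha2 : a2minus ≤ a2plus)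
    {n : ℕ} (hn : 1 ≤ n) {N' : ℕ} (hN' : 1 ≤ N') (α : ℝ) (μ : Fin (d + 1)) {t : ℕ} (ht : 1 ≤ t)
    {x : Fin (d + 1) → ℤ} (hx : x ∈ boxDom (fun _ : Fin (d + 1) => n * ((ℓ + 1) * N')))
    (hxe : x + Pi.single μ 1 ∈ boxDom (fun _ : Fin (d + 1) => n * ((ℓ + 1) * N')))
    (hx' : x + Pi.single μ (t : ℤ) ∈ boxDom (fun _ : Fin (d + 1) => n * ((ℓ + 1) * N')))
    (hx'e : x + Pi.single μ (t : ℤ) + Pi.single μ 1 ∈ boxDom (fun _ : Fin (d + 1) => n * ((ℓ + 1) * N')))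
    (h0U : (0 : Fin (d + 1) → ℤ) ∈ boxDom (fun _ : Fin (d + 1) => (ℓ + 1) * N')) :
    (meshFam d ℓ aminus aplus m2plus a2minus a2plus n ⟨meshIdx d ℓ hn ha' hm2 ha2 N' hN', rfl⟩).lhs236 α μ
        ⟨x, hx⟩ ⟨x + Pi.single μ (t : ℤ), hx'⟩ ⟨0, h0U⟩
      = ((n : ℝ) / t) ^ α * ((n : ℝ) *
        |(uB n aminus 0 (fun _ : Fin (d + 1) => (ℓ + 1) * N') ⟨_, hx'e⟩
            - uB n aminus 0 (fun _ : Fin (d + 1) => (ℓ + 1) * N') ⟨_, hx'⟩)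
          - (uB n aminus 0 (fun _ : Fin (d + 1) => (ℓ + 1) * N') ⟨_, hxe⟩
            - uB n aminus 0 (fun _ : Fin (d + 1) => (ℓ + 1) * N') ⟨x, hx⟩)|) := by
  have hg : x + Pi.single μ 1 ∈ boxDom (fun _ : Fin (d + 1) => n * ((ℓ + 1) * N')) ∧
      x + Pi.single μ (t : ℤ) + Pi.single μ 1 ∈ boxDom (fun _ : Fin (d + 1) => n * ((ℓ + 1) * N')) ∧
      x + Pi.single μ (t : ℤ) ≠ x := ⟨hxe, hx'e, add_single_ne x μ ht⟩
  have hM : ∀ i : Fin (d + 1), 1 ≤ (fun _ : Fin (d + 1) => (ℓ + 1) * N') i :=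
    fun _ => le_trans hN' (Nat.le_mul_of_pos_left _ (Nat.succ_pos ℓ))
  dsimp only [meshFam, zeroFieldScales, meshIdx, ScaleIdx.M]
  rw [dif_pos hg, boxOp_inv_eq_map hn ha le_rfl hM, sum_blk_bracket, ← Complex.ofReal_natCast,
    ← Complex.ofReal_mul, Complex.norm_real, Real.norm_eq_abs, abs_mul, Nat.abs_cast, add_sub_cancel_left,
    B4Lemma24ZeroBoxAlphaNeg.supNorm_single, Nat.abs_cast, Int.cast_natCast]

/-- on a mesh-`n` member the decay distance of (2.36) is `min(|ξx|_∞, |ξx′|_∞) ≤ |x|_∞/n` and non-negative.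
[folklore] -/
theorem member_dist2F (ha' : aminus ≤ aplus) (hm2 : 0 ≤ m2plus) (ha2 : a2minus ≤ a2plus)
    {n : ℕ} (hn : 1 ≤ n) {N' : ℕ} (hN' : 1 ≤ N')
    {x x' : Fin (d + 1) → ℤ} (hx : x ∈ boxDom (fun _ : Fin (d + 1) => n * ((ℓ + 1) * N')))
    (hx' : x' ∈ boxDom (fun _ : Fin (d + 1) => n * ((ℓ + 1) * N')))
    (h0U : (0 : Fin (d + 1) → ℤ) ∈ boxDom (fun _ : Fin (d + 1) => (ℓ + 1) * N')) :
    0 ≤ (meshFam d ℓ aminus aplus m2plus a2minus a2plus n ⟨meshIdx d ℓ hn ha' hm2 ha2 N' hN', rfl⟩).dist2F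
        ⟨x, hx⟩ ⟨x', hx'⟩ ⟨0, h0U⟩ ∧
      (meshFam d ℓ aminus aplus m2plus a2minus a2plus n ⟨meshIdx d ℓ hn ha' hm2 ha2 N' hN', rfl⟩).dist2F
        ⟨x, hx⟩ ⟨x', hx'⟩ ⟨0, h0U⟩ ≤ supNorm x / n := by
  dsimp only [meshFam, zeroFieldScales, meshIdx, ScaleIdx.M]
  refine ⟨le_min (fdist_nonneg _ _ _) (fdist_nonneg _ _ _), ?_⟩
  rw [← fdist_zero n x]
  exact min_le_left _ _

/-- the member is «large»: `rectLarge = True`. [folklore] -/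
theorem member_rectLarge (ha' : aminus ≤ aplus) (hm2 : 0 ≤ m2plus) (ha2 : a2minus ≤ a2plus)
    {n : ℕ} (hn : 1 ≤ n) {N' : ℕ} (hN' : 1 ≤ N') :
    (meshFam d ℓ aminus aplus m2plus a2minus a2plus n ⟨meshIdx d ℓ hn ha' hm2 ha2 N' hN', rfl⟩).rectLarge :=
  trivial

/-- the extension by `0` of the block column to the lattice (for the axis profile). [folklore] -/
def extU (n : ℕ) (a m2 : ℝ) (M : Fin (d + 1) → ℕ) (z : Fin (d + 1) → ℤ) : ℝ :=
  if h : z ∈ boxDom (fun j => n * M j) then uB n a m2 M ⟨z, h⟩ else 0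

/-- on the box the extension is the block column. [folklore] -/
theorem extU_of_mem (n : ℕ) (a m2 : ℝ) (M : Fin (d + 1) → ℕ) {z : Fin (d + 1) → ℤ}
    (h : z ∈ boxDom (fun j => n * M j)) : extU n a m2 M z = uB n a m2 M ⟨z, h⟩ := by
  rw [extU, dif_pos h]

end Member

/-! ## §5  The refutation at EVERY fixed mesh `n ≥ 1` -/

section Refutation

variable {ℓ : ℕ} {aminus aplus m2plus a2minus a2plus : ℝ}

set_option maxHeartbeats 400000 in
/-- **THE TYPED (2.36) CLAUSE FAILS FOR EVERY `α < 0` ALREADY ON THE MESH-`n` SUB-FAMILY, FOR EVERY FIXED MESH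
`n ≥ 1`** (every window with `a₋ > 0`, every `L = ℓ + 1 ≥ 1`, every dimension, every rate `δ₀ ∈ ℝ`): no constant
`c₁` bounds `lhs236 α` by `c₁e^{−δ₀·dist2F}` on all mesh-`n` cubes.  Mechanism: the block column `u = G_j(□)Q_j^*(·,0)`
of the mesh-`n` cube (`m² = 0`, `a_j = a₋`) has total mass `n^{d+1}/a₋` (§1) and decays like `C e^{−(κ/n)|x|_∞}`
uniformly in the box (§2, the tree's (2.35)); so a box-independent near region `{|x|_∞ < K}` carries mass `≥ 3/4`
of it and contains a point with `u ≥ c′ = n^{d+1}/(4a₋K^{d+1})`; walking `K₁` steps along the axis `e₀` to where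
`|u| ≤ c′/2` pigeonholes a bond `x, x+e₀` with `u(x+e₀) − u(x) ≤ −c″`; at the far point `x′ = x + n t₀·e₀` the bond
difference is `≤ c″/2` in absolute value, so the bracket of (2.36) is `≥ n c″/2`, the typed weight is
`(n/|x′−x|_∞)^α = t₀^{−α} ≥ 4B/(n c″)` and the typed right side is `≤ B = c₁e^{|δ₀|(K+K₁)}` — contradiction
(`2B ≤ B`) in the cube of `K + K₁ + n t₀ + 2` blocks per side.
[cite: Balaban1983RegularityDecay, p. 582 Lemma 2.4 (2.36) «for α < 1» — the literal range read with α < 0 at ONE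
arbitrary scale j (mesh n = L^j), case A = 0; typed clause `B4Lemma24ZeroBoxScale.Bound236` = the second conjunct
of `B4.Lemma24Printed` at one α, on the sub-family `meshFam`] -/
theorem not_bound236_meshFam (d ℓ : ℕ) {aminus aplus m2plus a2minus a2plus : ℝ} (ha : 0 < aminus)
    (ha' : aminus ≤ aplus) (hm2 : 0 ≤ m2plus) (ha2 : a2minus ≤ a2plus) {n : ℕ} (hn : 1 ≤ n)
    {α : ℝ} (hα : α < 0) (δ₀ : ℝ) :
    ¬ Bound236 (meshFam d ℓ aminus aplus m2plus a2minus a2plus n) δ₀ α := by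
  classical
  rintro ⟨c₁, hc₁, hB⟩
  -- (2.35) for the block column in the fine sup-norm: |u(x)| ≤ C e^{−r|x|_∞}, r = κ/n
  obtain ⟨κ, C, hκ, hC, hdec⟩ := uB_decay d aminus aplus m2plus ha
  have hn0 : (0 : ℝ) < n := by exact_mod_cast hn
  obtain ⟨r, hr_def⟩ : ∃ r : ℝ, r = κ / n := ⟨_, rfl⟩
  have hr : 0 < r := by rw [hr_def]; positivity
  -- the lattice sum T = Σ_v e^{−(r/2)|v|_∞} and the total mass M₀ = n^{d+1}/a₋
  obtain ⟨T, hT_def⟩ : ∃ T : ℝ, T = ∑' v : Fin (d + 1) → ℤ, Real.exp (-(r / 2 * supNorm v)) := ⟨_, rfl⟩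
  have hT0 : 0 ≤ T := by rw [hT_def]; exact tsum_exp_nonneg _
  obtain ⟨M₀, hM₀_def⟩ : ∃ M₀ : ℝ, M₀ = (n : ℝ) ^ (d + 1) / aminus := ⟨_, rfl⟩
  have hM₀ : 0 < M₀ := by rw [hM₀_def]; positivity
  -- the near radius K, the near lower bound c′, the walk length K₁, the bond constant c″, the far threshold K₂
  obtain ⟨K, hK1, hKq⟩ : ∃ K : ℕ, 1 ≤ K ∧ 4 * (C * T) / ((r / 2) * M₀) < K :=
    ⟨natAbove _, one_le_natAbove _, lt_natAbove _⟩
  have hK0 : (0 : ℝ) < K := by exact_mod_cast hK1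
  obtain ⟨c', hc'_def⟩ : ∃ c' : ℝ, c' = M₀ / (4 * (K : ℝ) ^ (d + 1)) := ⟨_, rfl⟩
  have hc' : 0 < c' := by rw [hc'_def]; positivity
  obtain ⟨K₁, hK₁1, hK₁q⟩ : ∃ K₁ : ℕ, 1 ≤ K₁ ∧ 2 * C / (r * c') < K₁ :=
    ⟨natAbove _, one_le_natAbove _, lt_natAbove _⟩
  have hK₁0 : (0 : ℝ) < K₁ := by exact_mod_cast hK₁1
  obtain ⟨c'', hc''_def⟩ : ∃ c'' : ℝ, c'' = c' / 2 / K₁ := ⟨_, rfl⟩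
  have hc'' : 0 < c'' := by rw [hc''_def]; positivity
  obtain ⟨K₂, hK₂1, hK₂q⟩ : ∃ K₂ : ℕ, 1 ≤ K₂ ∧ 4 * C / (r * c'') < K₂ :=
    ⟨natAbove _, one_le_natAbove _, lt_natAbove _⟩
  have hK₂0 : (0 : ℝ) < K₂ := by exact_mod_cast hK₂1
  -- the box-independent bound B of the typed right side and the far scale t₀ (far shift P = n·t₀ fine steps)
  obtain ⟨B, hB_def⟩ : ∃ B : ℝ, B = c₁ * Real.exp (|δ₀| * ((K : ℝ) + K₁)) := ⟨_, rfl⟩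
  have hBpos : 0 < B := by rw [hB_def]; positivity
  have hnc : 0 < (n : ℝ) * c'' := by positivity
  obtain ⟨t₀, ht₀_def⟩ : ∃ t₀ : ℕ, t₀ = B4Lemma24ZeroBoxAlphaNeg.farT B (n * c'') α + K₂ := ⟨_, rfl⟩
  have ht₀far : B4Lemma24ZeroBoxAlphaNeg.farT B (n * c'') α ≤ t₀ := by omega
  have ht₀K₂ : K₂ ≤ t₀ := by omega
  obtain ⟨P, hP_def⟩ : ∃ P : ℕ, P = n * t₀ := ⟨_, rfl⟩
  have hPt₀ : t₀ ≤ P := by rw [hP_def]; exact Nat.le_mul_of_pos_left _ (by omega)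
  have hP1 : 1 ≤ P := le_trans hK₂1 (le_trans ht₀K₂ hPt₀)
  -- the member: the mesh-n cube of N′ = K + K₁ + P + 2 blocks per side
  obtain ⟨N', hN'_def⟩ : ∃ N' : ℕ, N' = K + K₁ + P + 2 := ⟨_, rfl⟩
  have hN'1 : 1 ≤ N' := by omega
  have hbig : K + K₁ + P + 2 ≤ n * ((ℓ + 1) * N') := by
    rw [← hN'_def]
    exact le_trans (Nat.le_mul_of_pos_left _ (Nat.succ_pos ℓ)) (Nat.le_mul_of_pos_left _ (by omega))
  have hU1 : ∀ j : Fin (d + 1), 1 ≤ (fun _ : Fin (d + 1) => (ℓ + 1) * N') j :=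
    fun _ => le_trans hN'1 (Nat.le_mul_of_pos_left _ (Nat.succ_pos ℓ))
  have h0U : (0 : Fin (d + 1) → ℤ) ∈ boxDom (fun _ : Fin (d + 1) => (ℓ + 1) * N') := zero_mem_boxDom hU1
  -- the block column u of this member: decay and total mass
  obtain ⟨u, hu_def⟩ : ∃ u : ↥(boxDom (fun _ : Fin (d + 1) => n * ((ℓ + 1) * N'))) → ℝ,
      u = uB n aminus 0 (fun _ : Fin (d + 1) => (ℓ + 1) * N') := ⟨_, rfl⟩
  have hdx : ∀ x : ↥(boxDom (fun _ : Fin (d + 1) => n * ((ℓ + 1) * N'))),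
      |u x| ≤ C * Real.exp (-(r * supNorm x.1)) := by
    intro x
    rw [hu_def, hr_def]
    exact hdec n hn aminus 0 le_rfl ha' le_rfl hm2 _ hU1 x
  have hmass : ∑ x, u x = M₀ := by
    have h := uB_mass (d := d) hn ha (le_refl (0 : ℝ)) hU1
    rw [zero_add, ← hu_def] at h
    rw [hM₀_def, eq_div_iff ha.ne']
    linarith
  -- near / far split of the mass: the far part is at most M₀/4
  have hsplit := Finset.sum_filter_add_sum_filter_not (Finset.univ)
    (fun x : ↥(boxDom (fun _ : Fin (d + 1) => n * ((ℓ + 1) * N'))) => ∀ i, x.1 i < K) u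
  have hfar : ∑ x ∈ Finset.univ.filter
      (fun x : ↥(boxDom (fun _ : Fin (d + 1) => n * ((ℓ + 1) * N'))) => ¬ ∀ i, x.1 i < K), u x
        ≤ C * Real.exp (-(r / 2 * K)) * T := by
    calc ∑ x ∈ Finset.univ.filter
          (fun x : ↥(boxDom (fun _ : Fin (d + 1) => n * ((ℓ + 1) * N'))) => ¬ ∀ i, x.1 i < K), u x
        ≤ ∑ x ∈ Finset.univ.filter
            (fun x : ↥(boxDom (fun _ : Fin (d + 1) => n * ((ℓ + 1) * N'))) => ¬ ∀ i, x.1 i < K),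
            C * Real.exp (-(r / 2 * K)) * Real.exp (-(r / 2 * supNorm x.1)) := by
          refine Finset.sum_le_sum fun x hx => ?_
          have hxK : (K : ℝ) ≤ supNorm x.1 := supNorm_ge_of_not_near x (Finset.mem_filter.1 hx).2
          refine ((le_abs_self (u x)).trans (hdx x)).trans ?_
          rw [mul_assoc, ← Real.exp_add]
          refine mul_le_mul_of_nonneg_left (Real.exp_le_exp.2 ?_) hC
          nlinarith [mul_le_mul_of_nonneg_left hxK hr.le]
      _ = C * Real.exp (-(r / 2 * K)) * ∑ x ∈ Finset.univ.filter
            (fun x : ↥(boxDom (fun _ : Fin (d + 1) => n * ((ℓ + 1) * N'))) => ¬ ∀ i, x.1 i < K),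
            Real.exp (-(r / 2 * supNorm x.1)) := by rw [Finset.mul_sum]
      _ ≤ C * Real.exp (-(r / 2 * K)) * ∑ x : ↥(boxDom (fun _ : Fin (d + 1) => n * ((ℓ + 1) * N'))),
            Real.exp (-(r / 2 * supNorm x.1)) := by
          refine mul_le_mul_of_nonneg_left ?_ (by positivity)
          exact Finset.sum_le_sum_of_subset_of_nonneg (Finset.filter_subset _ _)
            fun _ _ _ => (Real.exp_pos _).le
      _ ≤ C * Real.exp (-(r / 2 * K)) * T := by
          refine mul_le_mul_of_nonneg_left ?_ (by positivity)
          rw [hT_def]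
          exact sum_box_exp_le_tsum (by positivity) _
  have htail : C * Real.exp (-(r / 2 * K)) * T ≤ M₀ / 4 := by
    have h1 : Real.exp (-(r / 2 * K)) ≤ 1 / (r / 2 * K) := by
      rw [Real.exp_neg, ← one_div]
      exact one_div_le_one_div_of_le (by positivity) (by linarith [Real.add_one_le_exp (r / 2 * K)])
    have h2 : 4 * (C * T) < K * ((r / 2) * M₀) := by rwa [div_lt_iff₀ (by positivity)] at hKq
    calc C * Real.exp (-(r / 2 * K)) * T ≤ C * (1 / (r / 2 * K)) * T := by gcongr
      _ = C * T / (r / 2 * K) := by ring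
      _ ≤ M₀ / 4 := by rw [div_le_iff₀ (by positivity)]; nlinarith
  -- a near point x₁ (all coordinates < K) with u(x₁) ≥ c′
  obtain ⟨x₁, hx₁P, hx₁u⟩ : ∃ x₁ : ↥(boxDom (fun _ : Fin (d + 1) => n * ((ℓ + 1) * N'))),
      (∀ i, x₁.1 i < K) ∧ c' ≤ u x₁ := by
    by_contra hne
    push Not at hne
    have hle : ∑ x ∈ Finset.univ.filter
        (fun x : ↥(boxDom (fun _ : Fin (d + 1) => n * ((ℓ + 1) * N'))) => ∀ i, x.1 i < K), u x
          ≤ ∑ x ∈ Finset.univ.filter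
            (fun x : ↥(boxDom (fun _ : Fin (d + 1) => n * ((ℓ + 1) * N'))) => ∀ i, x.1 i < K), c' :=
      Finset.sum_le_sum fun x hx => (hne x (Finset.mem_filter.1 hx).2).le
    rw [Finset.sum_const, nsmul_eq_mul] at hle
    have hcard : ((Finset.univ.filter
        (fun x : ↥(boxDom (fun _ : Fin (d + 1) => n * ((ℓ + 1) * N'))) => ∀ i, x.1 i < K)).card : ℝ)
          ≤ (K : ℝ) ^ (d + 1) := by exact_mod_cast card_near_le _ K
    have e : (K : ℝ) ^ (d + 1) * c' = M₀ / 4 := by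
      rw [hc'_def]
      field_simp
    nlinarith [mul_le_mul_of_nonneg_right hcard hc'.le]
  -- the axis points x₁ + m·e₀, m ≤ K₁ + P + 1, lie in the box
  have hx₁0 : x₁.1 0 < K := hx₁P 0
  have hmem : ∀ m : ℕ, m ≤ K₁ + P + 1 →
      x₁.1 + Pi.single (0 : Fin (d + 1)) (m : ℤ) ∈ boxDom (fun _ : Fin (d + 1) => n * ((ℓ + 1) * N')) := by
    intro m hm
    refine add_single_mem_cube x₁.2 0 ?_
    have h1 : ((K + K₁ + P + 2 : ℕ) : ℤ) ≤ ((n * ((ℓ + 1) * N') : ℕ) : ℤ) := by exact_mod_cast hbig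
    push_cast at h1 ⊢
    omega
  -- the axis profile m ↦ u(x₁ + m·e₀): value ≥ c′ at m = 0, ≤ c′/2 at m = K₁; a pigeonholed bond
  obtain ⟨f, hf_def⟩ : ∃ f : ℕ → ℝ, f = fun m : ℕ =>
      extU n aminus 0 (fun _ : Fin (d + 1) => (ℓ + 1) * N') (x₁.1 + Pi.single (0 : Fin (d + 1)) (m : ℤ)) :=
    ⟨_, rfl⟩
  have hf0 : f 0 = u x₁ := by
    rw [hf_def]
    dsimp only
    rw [extU_of_mem n aminus 0 _ (hmem 0 (by omega)), hu_def]
    congr 1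
    exact Subtype.ext (by simp)
  have hxK₁ := hmem K₁ (by omega)
  have hfK₁ : f K₁ ≤ c' / 2 := by
    rw [hf_def]
    dsimp only
    rw [extU_of_mem n aminus 0 _ hxK₁, ← hu_def]
    have hs : (K₁ : ℝ) ≤ supNorm (x₁.1 + Pi.single (0 : Fin (d + 1)) ((K₁ : ℕ) : ℤ)) := by
      have h := abs_le_supNorm (x₁.1 + Pi.single (0 : Fin (d + 1)) ((K₁ : ℕ) : ℤ)) 0
      rw [Pi.add_apply, Pi.single_eq_same] at h
      have h0 := (mem_boxDom.1 x₁.2 0).1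
      have h3 : ((K₁ : ℤ) : ℝ) ≤ (((x₁.1 0 + (K₁ : ℕ) : ℤ)) : ℝ) := by exact_mod_cast (by omega)
      rw [abs_of_nonneg (by omega)] at h
      exact (by exact_mod_cast h3 : (K₁ : ℝ) ≤ _).trans h
    exact (le_abs_self _).trans (((hdx ⟨_, hxK₁⟩).trans (decay_far hC hr hK₁0 hs)).trans
      (thresh hr hc' (by norm_num) hK₁1 hK₁q))
  have hfK : f K₁ - f 0 ≤ -(c' / 2) := by linarith
  obtain ⟨k, hk, hstep⟩ := exists_step_le hK₁1 hfK
  rw [hf_def] at hstep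
  dsimp only at hstep
  -- the bond base point x = x₁ + k·e₀, its forward neighbour, the far point x′ = x + P·e₀ and its neighbour
  have hxF := hmem k (by omega)
  have hxeF' := hmem (k + 1) (by omega)
  have hxeF : x₁.1 + Pi.single (0 : Fin (d + 1)) (k : ℤ) + Pi.single 0 1
      ∈ boxDom (fun _ : Fin (d + 1) => n * ((ℓ + 1) * N')) := by
    have e : x₁.1 + Pi.single (0 : Fin (d + 1)) (k : ℤ) + Pi.single 0 1
        = x₁.1 + Pi.single (0 : Fin (d + 1)) ((k + 1 : ℕ) : ℤ) := by
      rw [add_assoc, ← Pi.single_add]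
      push_cast
      rfl
    rw [e]
    exact hxeF'
  have hx'F : x₁.1 + Pi.single (0 : Fin (d + 1)) (k : ℤ) + Pi.single 0 (P : ℤ)
      ∈ boxDom (fun _ : Fin (d + 1) => n * ((ℓ + 1) * N')) := by
    have e : x₁.1 + Pi.single (0 : Fin (d + 1)) (k : ℤ) + Pi.single 0 (P : ℤ)
        = x₁.1 + Pi.single (0 : Fin (d + 1)) ((k + P : ℕ) : ℤ) := by
      rw [add_assoc, ← Pi.single_add]
      push_cast
      rfl
    rw [e]
    exact hmem (k + P) (by omega)
  have hx'eF : x₁.1 + Pi.single (0 : Fin (d + 1)) (k : ℤ) + Pi.single 0 (P : ℤ) + Pi.single 0 1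
      ∈ boxDom (fun _ : Fin (d + 1) => n * ((ℓ + 1) * N')) := by
    have e : x₁.1 + Pi.single (0 : Fin (d + 1)) (k : ℤ) + Pi.single 0 (P : ℤ) + Pi.single 0 1
        = x₁.1 + Pi.single (0 : Fin (d + 1)) ((k + P + 1 : ℕ) : ℤ) := by
      rw [add_assoc, add_assoc, ← Pi.single_add, ← Pi.single_add]
      push_cast
      rfl
    rw [e]
    exact hmem (k + P + 1) (by omega)
  -- the bond: u(x+e₀) − u(x) ≤ −c″
  rw [extU_of_mem n aminus 0 _ hxeF', extU_of_mem n aminus 0 _ hxF, ← hu_def] at hstep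
  have hpt : (⟨x₁.1 + Pi.single (0 : Fin (d + 1)) ((k + 1 : ℕ) : ℤ), hxeF'⟩ :
        ↥(boxDom (fun _ : Fin (d + 1) => n * ((ℓ + 1) * N'))))
      = ⟨x₁.1 + Pi.single (0 : Fin (d + 1)) (k : ℤ) + Pi.single 0 1, hxeF⟩ :=
    Subtype.ext (by push_cast; rw [add_assoc, ← Pi.single_add])
  rw [hpt] at hstep
  have hbond : u ⟨_, hxeF⟩ - u ⟨_, hxF⟩ ≤ -c'' := by
    rw [hc''_def]
    exact hstep
  -- the far bond is small: |u(x′+e₀) − u(x′)| ≤ c″/2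
  have hcoord : ∀ (z : Fin (d + 1) → ℤ) (hz : (P : ℤ) ≤ z 0), (K₂ : ℝ) ≤ supNorm z := by
    intro z hz
    have h := abs_le_supNorm z 0
    have hP' : (K₂ : ℤ) ≤ z 0 := le_trans (by exact_mod_cast le_trans ht₀K₂ hPt₀) hz
    rw [abs_of_nonneg (by omega)] at h
    exact (by exact_mod_cast hP' : (K₂ : ℝ) ≤ ((z 0 : ℤ) : ℝ)).trans h
  have hx₁00 : 0 ≤ x₁.1 0 := (mem_boxDom.1 x₁.2 0).1
  have hs1 : (K₂ : ℝ) ≤ supNorm (x₁.1 + Pi.single (0 : Fin (d + 1)) (k : ℤ) + Pi.single 0 (P : ℤ)) :=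
    hcoord _ (by simp only [Pi.add_apply, Pi.single_eq_same]; omega)
  have hs2 : (K₂ : ℝ) ≤
      supNorm (x₁.1 + Pi.single (0 : Fin (d + 1)) (k : ℤ) + Pi.single 0 (P : ℤ) + Pi.single 0 1) :=
    hcoord _ (by simp only [Pi.add_apply, Pi.single_eq_same]; omega)
  have hfar1 : |u ⟨_, hx'eF⟩| ≤ c'' / 4 :=
    ((hdx ⟨_, hx'eF⟩).trans (decay_far hC hr hK₂0 hs2)).trans (thresh hr hc'' (by norm_num) hK₂1 hK₂q)
  have hfar2 : |u ⟨_, hx'F⟩| ≤ c'' / 4 :=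
    ((hdx ⟨_, hx'F⟩).trans (decay_far hC hr hK₂0 hs1)).trans (thresh hr hc'' (by norm_num) hK₂1 hK₂q)
  have hfarval : |u ⟨_, hx'eF⟩ - u ⟨_, hx'F⟩| ≤ c'' / 2 :=
    (abs_sub _ _).trans (by linarith)
  -- the bracket of (2.36): |(u(x′+e₀) − u(x′)) − (u(x+e₀) − u(x))| ≥ c″/2
  have hΔ : c'' / 2 ≤ |(u ⟨_, hx'eF⟩ - u ⟨_, hx'F⟩) - (u ⟨_, hxeF⟩ - u ⟨_, hxF⟩)| := by
    have h := neg_abs_le (u ⟨_, hx'eF⟩ - u ⟨_, hx'F⟩)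
    exact le_trans (by linarith) (le_abs_self _)
  -- the typed (2.36) instance at (μ = 0, x, x′ = x + P·e₀, y = 0) of the member, and its right side ≤ B
  obtain ⟨hD0, hDle⟩ := member_dist2F (d := d) (ℓ := ℓ) (aminus := aminus) (aplus := aplus)
    (m2plus := m2plus) (a2minus := a2minus) (a2plus := a2plus) ha' hm2 ha2 hn hN'1 hxF hx'F h0U
  have hsx : supNorm (x₁.1 + Pi.single (0 : Fin (d + 1)) (k : ℤ)) / n ≤ (K : ℝ) + K₁ := by
    have h1 : supNorm (x₁.1 + Pi.single (0 : Fin (d + 1)) (k : ℤ)) ≤ ((K + K₁ : ℕ) : ℝ) := by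
      refine supNorm_le_of_near ⟨_, hxF⟩ fun i => ?_
      dsimp only
      by_cases hi : i = 0
      · subst hi
        rw [Pi.add_apply, Pi.single_eq_same]
        push_cast
        omega
      · rw [Pi.add_apply, Pi.single_eq_of_ne hi, add_zero]
        have := hx₁P i
        push_cast
        omega
    push_cast at h1
    exact (div_le_self (supNorm_nonneg _) (by exact_mod_cast hn)).trans h1
  have hDK := hDle.trans hsx
  have key := hB ⟨meshIdx d ℓ hn ha' hm2 ha2 N' hN'1, rfl⟩ trivial (0 : Fin (d + 1)) ⟨_, hxF⟩ ⟨_, hx'F⟩ ⟨0, h0U⟩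
  have key2 : (meshFam d ℓ aminus aplus m2plus a2minus a2plus n ⟨meshIdx d ℓ hn ha' hm2 ha2 N' hN'1, rfl⟩).lhs236
      α (0 : Fin (d + 1)) ⟨_, hxF⟩ ⟨_, hx'F⟩ ⟨0, h0U⟩ ≤ B := by
    refine key.trans ?_
    rw [hB_def]
    refine mul_le_mul_of_nonneg_left (Real.exp_le_exp.2 ?_) hc₁.le
    nlinarith [mul_le_mul_of_nonneg_left hDK (abs_nonneg δ₀), mul_le_mul_of_nonneg_right (neg_le_abs δ₀) hD0]
  rw [member_lhs236 ha ha' hm2 ha2 hn hN'1 α 0 hP1 hxF hxeF hx'F hx'eF h0U, ← hu_def] at key2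
  -- the weight (n/P)^α = t₀^{−α} ≥ 4B/(n c″)
  have hw : 4 * B / (n * c'') ≤ ((n : ℝ) / P) ^ α := by
    have hP : (P : ℝ) = n * t₀ := by rw [hP_def]; push_cast; ring
    have ht0 : (0 : ℝ) ≤ t₀ := Nat.cast_nonneg _
    rw [hP, show (n : ℝ) / ((n : ℝ) * (t₀ : ℝ)) = 1 / t₀ from by rw [div_mul_eq_div_div, div_self hn0.ne'],
      one_div, Real.inv_rpow ht0, ← Real.rpow_neg ht0]
    exact B4Lemma24ZeroBoxAlphaNeg.farT_spec hBpos hnc hα ht₀far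
  -- left side ≥ (4B/(n c″))·(n·c″/2) = 2B > B ≥ left side
  have hprod := mul_le_mul hw (mul_le_mul_of_nonneg_left hΔ hn0.le) (by positivity) (le_trans (by positivity) hw)
  have e : 4 * B / (n * c'') * ((n : ℝ) * (c'' / 2)) = 2 * B := by
    field_simp
    ring
  rw [e] at hprod
  linarith

/-- **AT EVERY SCALE `j` (mesh `n = L^j`, `j ≥ 0` arbitrary — in particular `j ≥ 1`)** the typed (2.36) clause
fails for `α < 0` on the scale-`j` sub-family: excluding `j = 0` does not rescue the literal binder
`∀ α : ℝ, α < 1`. [cite: Balaban1983RegularityDecay, p. 582 Lemma 2.4 «for arbitrary non-negative integer j»,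
(2.36) «for α<1»; typed clause `B4Lemma24ZeroBoxScale.Bound236`] -/
theorem not_bound236_scale (d ℓ j : ℕ) {aminus aplus m2plus a2minus a2plus : ℝ} (ha : 0 < aminus)
    (ha' : aminus ≤ aplus) (hm2 : 0 ≤ m2plus) (ha2 : a2minus ≤ a2plus) {α : ℝ} (hα : α < 0) (δ₀ : ℝ) :
    ¬ Bound236 (meshFam d ℓ aminus aplus m2plus a2minus a2plus ((ℓ + 1) ^ j)) δ₀ α :=
  not_bound236_meshFam d ℓ ha ha' hm2 ha2 (Nat.one_le_pow _ _ (Nat.succ_pos ℓ)) hα δ₀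

/-- **THE TYPED LEAF FAILS ON EVERY FIXED-MESH SUB-FAMILY**: `¬ B4.Lemma24Printed (meshFam … n)` for every
`n ≥ 1` (instance `α = −1` of its second conjunct). [cite: Balaban1983RegularityDecay, p. 582 Lemma 2.4
(2.35)–(2.37); typed leaf `B4.Lemma24Printed` (B4.lean), read through `lemma24Printed_iff` (`Iff.rfl`)] -/
theorem not_lemma24Printed_meshFam (d ℓ : ℕ) {aminus aplus m2plus a2minus a2plus : ℝ} (ha : 0 < aminus)
    (ha' : aminus ≤ aplus) (hm2 : 0 ≤ m2plus) (ha2 : a2minus ≤ a2plus) {n : ℕ} (hn : 1 ≤ n) :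
    ¬ B4.Lemma24Printed (meshFam d ℓ aminus aplus m2plus a2minus a2plus n) := by
  rw [lemma24Printed_iff]
  rintro ⟨c₀, δ₀, -, -, -, h236⟩
  exact not_bound236_meshFam d ℓ ha ha' hm2 ha2 hn (show (-1 : ℝ) < 0 by norm_num) δ₀ (h236 (-1) (by norm_num))

end Refutation

/-! ## §6  Examples: `d + 1 = 4`, `L = 2`, window `a_j ∈ [1/2, 2]`, `m_j² ∈ [0, 1]`, `a ∈ [1/2, 2]` -/

section

/-- node 22's theorem once more, through the mesh-1 sub-family and `bound236_comp` (a second proof, by the mass/decay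
mechanism of this file instead of the minimum principle; the THEOREM is node 22's
`B4Lemma24ZeroBoxAlphaNeg.not_bound236_zeroFieldScales` and is not restated). -/
example (d ℓ : ℕ) {aminus aplus m2plus a2minus a2plus : ℝ} (ha : 0 < aminus) (ha' : aminus ≤ aplus)
    (hm2 : 0 ≤ m2plus) (ha2 : a2minus ≤ a2plus) {α : ℝ} (hα : α < 0) (δ₀ : ℝ) :
    ¬ Bound236 (zeroFieldScales d ℓ aminus aplus m2plus a2minus a2plus) δ₀ α := fun h =>
  not_bound236_meshFam d ℓ ha ha' hm2 ha2 (le_refl 1) hα δ₀ (by rw [meshFam_eq_comp]; exact bound236_comp _ _ h)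

/-- at the scale `j = 1` (mesh `n = L = 2`) the typed (2.36) clause with `α = −1/2` has no constant at rate `0`. -/
example : ¬ Bound236 (meshFam 3 1 (1 / 2) 2 1 (1 / 2) 2 2) 0 (-1 / 2) :=
  not_bound236_meshFam 3 1 (by norm_num) (by norm_num) (by norm_num) (by norm_num) (by norm_num) (by norm_num) 0

/-- the typed leaf fails on the scale-`j` sub-family for every `j`. -/
example (j : ℕ) : ¬ B4.Lemma24Printed (meshFam 3 1 (1 / 2) 2 1 (1 / 2) 2 (2 ^ j)) :=
  not_lemma24Printed_meshFam 3 1 (by norm_num) (by norm_num) (by norm_num) (by norm_num) (Nat.one_le_two_pow)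

/-- the sub-family at scale `j = 5` is inhabited (mesh `32`, the cube of one `L`-block). -/
example : Nonempty {i : ScaleIdx 3 1 (1 / 2 : ℝ) 2 1 (1 / 2) 2 // i.n = 2 ^ 5} :=
  ⟨⟨meshIdx 3 1 (n := 2 ^ 5) (by norm_num) (by norm_num) (by norm_num) (by norm_num) 1 le_rfl, rfl⟩⟩

end

end

end Literature.MathematicalPhysics.QuantumFieldTheory.Balaban1983to89.B4Lemma24ZeroBoxAlphaNegMesh
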